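/-
Copyright (c) 2026. All rights reserved.
Released under Apache 2.0 license as described in the file LICENSE.
Authors: abc-iut cell, seat abc-iut-L4-t9 (gen 4; block W2-B2 — the lift datum `θ^bi` of [AbsTopIII] Cor 3.7 (ii)
pinned to Prop 3.2 (iv): `θ^bi` exists iff `(Π ↷ M) ↦ Π` is full, given that it is faithful).
-/
import Literature.AnabelianGeometry.AbsoluteAnabelian.AbsTopIII.BiAnabelianModelLiftVacuity
import Literature.AnabelianGeometry.AbsoluteAnabelian.AbsTopIII.BiAnabelianModelOfType
import Mathlib.CategoryTheory.Functor.FullyFaithful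
import HarnessLib

/-!
# [AbsTopIII] Cor 3.7 (ii): `θ^bi` = fullness of `(Π ↷ M) ↦ Π` (Prop 3.2 (iv) surjectivity), at the model

S. Mochizuki, *Topics in absolute anabelian geometry III* [MochizukiAbsTopIII2015] (kurims manuscript
`paper:url-5493eb38cbb7`).  Cor 3.7 (ii) p. 87: `θ^bi : pr^bi_1 ⥲ pr^bi_2` "arises from the functoriality —
i.e., the bi-anabelian [...] portion [...] — of the 'group-theoretic' algorithms of Corollary 1.10"; Prop 3.2
(iv) p. 72: "the natural functor `𝒞^{MLF}_T → 𝒯𝔾` [...] induces an injection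
`Isom_{𝒞^MLF_T}((Π ↷ M_T), (Π* ↷ M*_T)) ↪ Isom_{𝒯𝔾}(Π, Π*)`; this injection is a bijection if [...] `T ∈ {TM, TF}`
and both `(Π ↷ M_T)`, `(Π* ↷ M*_T)` are of strictly Belyi type".

PROOF/CONSTRUCTION-ONLY file (seat abc-iut-L4-t9 gen 4) closing the circle on the hypothesis structure
`FiberSquare.BiAnabelianLift` of the Cor 3.7 files: for a functor `Φ : 𝒳 ⥤ 𝔈`,

* `FiberSquare.BiAnabelianLift.ofFullyFaithful` — if `Φ` is FULL and FAITHFUL, the canonical lift datum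
  (`θ^bi_{(A₁,A₂,α)} := Φ⁻¹(α)`; naturality by faithfulness) — pure category theory;
* `FiberSquare.BiAnabelianLift.map_surjective_of_groupoid` — conversely a lift datum makes `Φ` full as soon as
  every morphism of `𝔈` is invertible (as in print's double-underlined `𝒯𝔾`, and gen 3's `TopGroupObj`);

and at the MODEL (`𝒳 = TFModel p`, `𝔈 = TopGroupObj`, `Φ = (Π ↷ M) ↦ Π` = gen 3's `TFModel.gal`):

* `TFModel.gal_map_injective` / `TFModel.gal_faithful` — **Prop 3.2 (iv) INJECTIVITY at the model,
  unconditionally** (`Isom_𝒳(A,B) ↪ Isom_{𝒯𝔾}(Π_A, Π_B)`: two Galois-isomorphisms with the same `φ_Π` agree,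
  by `Hom.galois_eq_refl_of_homPi_eq_self`, p417611); likewise on every full subcategory `𝒳_P`;
* `TFModel.biAnabelianLiftOfFull P hfull` — `θ^bi` for the `P`-sub-model from the SURJECTIVITY half of Prop 3.2
  (iv) for `P`-objects (`hfull : (P.ι ⋙ gal).Full`, print: `P` = strictly Belyi type, ⇐ Cor 1.10 / Thm 1.9);
* `TFModel.model_of_cor_3_7_of_full` — **Cor 3.7 (i)–(v) for the `P`-sub-model MODULO EXACTLY Prop 3.2 (iv)
  surjectivity for `P`** (gen 4's `model_of_cor_3_7` with `θ := biAnabelianLiftOfFull`);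
* `TFModel.not_full_gal_slim` — consistency: surjectivity FAILS for `P =` slim (the swap object of
  `BiAnabelianModelLiftVacuity`), as it must.

HONEST FRAMING: the residual input of Cor 3.7 at the model is thereby the printed Prop 3.2 (iv) bijectivity
for strictly-Belyi-type pairs — [AbsTopIII] Cor 1.10 / Thm 1.9 (campaign-L base), NOT proved here; the tree has
no étale `π₁`, so `P` stays abstract.  Nothing here bears on [IUTchIII] Cor. 3.12; typed ≠ discharged.
-/

set_option autoImplicit false

noncomputable section

namespace Literature.AnabelianGeometry.AbsoluteAnabelian.AbsTopIII

open CategoryTheory CategoryTheory.Limits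
open Literature.AlgebraicGeometry.Frobenioids (IsSlimGroup)

universe v₁ v₂ u₁ u₂

/-! ## Pure category theory: lift data from full faithfulness, and back -/

namespace FiberSquare.BiAnabelianLift

variable {X : Type u₁} [Category.{v₁} X] {E : Type u₂} [Category.{v₂} E] (Φ : X ⥤ E)

/-- **The canonical bi-anabelian lift datum of a FULL and FAITHFUL functor** `Φ : 𝒳 ⥤ 𝔈`: at
`(A₁, A₂, α : Φ A₁ ⥲ Φ A₂)` the unique `θ : A₁ ⥲ A₂` with `Φ(θ) = α` (`Functor.preimageIso`); naturality in
`(A₁, A₂, α)` holds because `Φ` is faithful.  (Print: for `𝒳 = 𝒞^{MLF-sB}_{T𝔽} → 𝔈 = 𝒯𝔾_{sB}` full faithfulness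
IS Prop 3.2 (iv) "this injection is a bijection [...] of strictly Belyi type", i.e. Cor 1.10.)
[cite: MochizukiAbsTopIII2015, Cor 3.7 (ii) p.87] -/
def ofFullyFaithful [Φ.Full] [Φ.Faithful] : BiAnabelianLift Φ where
  θbi := NatIso.ofComponents (fun o => Φ.preimageIso o.iso) (fun {o o'} f => Φ.map_injective (by
    simp only [CategoricalPullback.π₁_map, Functor.preimageIso_hom, Functor.map_comp, Functor.map_preimage,
      CategoricalPullback.π₂_map]
    exact f.w))
  map_θbi o := by simp

/-- Conversely, a bi-anabelian lift datum makes `Φ` FULL when every morphism of `𝔈` is an isomorphism (as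
for the double-underlined `𝒯𝔾` of Def 3.1 (iii)): `g : Φ A ⟶ Φ B` is `Φ(θ^bi_{(A,B,g)})`.
[cite: MochizukiAbsTopIII2015, Cor 3.7 (ii) p.87] -/
theorem map_surjective_of_groupoid {Φ : X ⥤ E} (θ : BiAnabelianLift Φ)
    (hE : ∀ {e e' : E} (g : e ⟶ e'), IsIso g) (A B : X) :
    Function.Surjective (Φ.map : (A ⟶ B) → (Φ.obj A ⟶ Φ.obj B)) := fun g => by
  haveI := hE g
  exact ⟨θ.θbi.hom.app ⟨A, B, asIso g⟩, θ.map_θbi ⟨A, B, asIso g⟩⟩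

/-- Hence `Φ` is full. [cite: MochizukiAbsTopIII2015, Cor 3.7 (ii) p.87] -/
theorem full_of_groupoid {Φ : X ⥤ E} (θ : BiAnabelianLift Φ) (hE : ∀ {e e' : E} (g : e ⟶ e'), IsIso g) :
    Φ.Full :=
  ⟨fun {A B} g => θ.map_surjective_of_groupoid hE A B g⟩

end FiberSquare.BiAnabelianLift

/-! ## At the model: Prop 3.2 (iv) injectivity is a theorem; surjectivity is the residual input -/

namespace TFModel

variable {p : ℕ} [hp : Fact p.Prime]

/-- **Prop 3.2 (iv), injectivity, AT THE MODEL (unconditional)**: two Galois-isomorphisms `A → B` of model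
`TF`-pairs with the same Galois component `φ_Π` coincide ("`Isom_{𝒞^MLF_TF}((Π ↷ M), (Π* ↷ M*)) ↪ Isom_{𝒯𝔾}(Π, Π*)`"):
`g ≫ g'⁻¹` has `φ_Π = id`, hence trivial field component by the slimness of `G_{ℚ_p}`
(`Hom.galois_eq_refl_of_homPi_eq_self`). [cite: MochizukiAbsTopIII2015, Proposition 3.2 (iv) p.72] -/
theorem gal_map_injective {A B : TFModel p} :
    Function.Injective ((TFModel.gal p).map : (A ⟶ B) → ((TFModel.gal p).obj A ⟶ (TFModel.gal p).obj B)) := by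
  intro g g' hgg'
  -- the endomorphism `a := g ≫ g'⁻¹` of `A` has identity Galois component
  let a : A ⟶ A := g ≫ (isoOfHom g').inv
  have hPi : ∀ x : A.pair.Pi, (a : Hom A A).hom.homPi x = x := fun x => by
    have e := congrArg (fun φ : TopGroupObj.Hom _ _ => φ.iso x) hgg'
    change (g : Hom A B).hom.homPi x = (g' : Hom A B).hom.homPi x at e
    change (g' : Hom A B).piIso.symm ((g : Hom A B).hom.homPi x) = x
    rw [e, ← Hom.piIso_apply, ContinuousMulEquiv.symm_apply_apply]
  have hσ := (a : Hom A A).galois_eq_refl_of_homPi_eq_self hPi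
  have ha : a = 𝟙 A := by
    apply Hom.ext; apply GaloisFieldPair.Hom.ext
    · exact MonoidHom.ext hPi
    · ext x
      change (a : Hom A A).hom.homM x = x
      rw [← Hom.galois_apply, hσ, AlgEquiv.coe_refl, id]
  calc g = (g ≫ (isoOfHom g').inv) ≫ (isoOfHom g').hom := by simp
    _ = g' := by rw [show g ≫ (isoOfHom g').inv = a from rfl, ha, Category.id_comp]; rfl

variable (p) in
/-- `(Π ↷ M) ↦ Π` is a FAITHFUL functor `𝒳 → 𝔈` (Prop 3.2 (iv) injectivity at the model).
[cite: MochizukiAbsTopIII2015, Proposition 3.2 (iv) p.72] -/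
theorem gal_faithful : (TFModel.gal p).Faithful := ⟨fun {_ _} => gal_map_injective⟩

/-- ... and so is its restriction to every full subcategory `𝒳_P`.
[cite: MochizukiAbsTopIII2015, Proposition 3.2 (iv) p.72] -/
theorem gal_faithful_of (P : ObjectProperty (TFModel p)) : (P.ι ⋙ TFModel.gal p).Faithful := by
  haveI := gal_faithful p
  exact Functor.Faithful.comp _ _

variable (p)

/-- **`θ^bi` for the `P`-sub-model from Prop 3.2 (iv) surjectivity for `P`-objects** (`hfull`: every
isomorphism of topological groups `Π_A ⥲ Π_B` between `P`-objects is the Galois component of a morphism of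
pairs — print: `P` = "of strictly Belyi type", where this is [AbsTopIII] Cor 1.10 / Thm 1.9): the canonical
lift datum of the then fully faithful functor `𝒳_P → 𝔈`.
[cite: MochizukiAbsTopIII2015, Cor 3.7 (ii) p.87] -/
def biAnabelianLiftOfFull (P : ObjectProperty (TFModel p)) (hfull : (P.ι ⋙ TFModel.gal p).Full) :
    FiberSquare.BiAnabelianLift ((modelSetting p).restrict P fun _ h => h).gal := by
  haveI := hfull
  haveI := gal_faithful_of P
  exact FiberSquare.BiAnabelianLift.ofFullyFaithful (P.ι ⋙ TFModel.gal p)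

/-- Every morphism of `𝔈 = TopGroupObj` (double-underlined `𝒯𝔾`) is an isomorphism.
[cite: MochizukiAbsTopIII2015, Definition 3.1 (iii) p.68] -/
theorem topGroupObj_isIso {e e' : TopGroupObj} (g : e ⟶ e') : IsIso g :=
  (TopGroupObj.isoOfHom g).isIso_hom

/-- Conversely, a lift datum for the `P`-sub-model gives Prop 3.2 (iv) surjectivity for `P`-objects; so at
the model `θ^bi` and Prop 3.2 (iv) surjectivity for `P` are EQUIVALENT data.
[cite: MochizukiAbsTopIII2015, Cor 3.7 (ii) p.87] -/
theorem full_of_biAnabelianLift (P : ObjectProperty (TFModel p))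
    (θ : FiberSquare.BiAnabelianLift ((modelSetting p).restrict P fun _ h => h).gal) :
    (P.ι ⋙ TFModel.gal p).Full :=
  θ.full_of_groupoid fun g => topGroupObj_isIso g

/-- **[AbsTopIII] Cor 3.7 (i)–(v) for the `P`-sub-model MODULO EXACTLY Prop 3.2 (iv) surjectivity for `P`**
(and the printed consequence `hP` of `P`: slim `Π_k`, [AbsTopI] Prop 2.3 (ii); `x₀` a `P`-object, for the
Lemma-3.4 witness): gen 4's `model_of_cor_3_7` with `θ := biAnabelianLiftOfFull`.
[cite: MochizukiAbsTopIII2015, Cor 3.7 pp.86–89] -/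
theorem model_of_cor_3_7_of_full (P : ObjectProperty (TFModel p))
    (hP : ∀ A : TFModel p, P A → IsSlimGroup A.pair.Pi) (x₀ : TFModel p) (hx₀ : P x₀)
    (hfull : (P.ι ⋙ TFModel.gal p).Full) :
    ((modelSetting p).restrict P fun _ h => h).Cor_3_7_i ∧
      ((modelSetting p).restrict P fun _ h => h).Cor_3_7_ii (biAnabelianLiftOfFull p P hfull) ∧
      Literature.AnabelianGeometry.AbsoluteAnabelian.AbsTopIII.BiAnabelianSetting.Cor_3_7_iii
        ((modelSetting p).restrict P fun _ h => h) ∧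
      ((modelSetting p).restrict P fun _ h => h).Cor_3_7_iv (biAnabelianLiftOfFull p P hfull) ∧
      ((modelSetting p).restrict P fun _ h => h).Cor_3_7_v :=
  model_of_cor_3_7 p P hP x₀ hx₀ _

/-- In particular **Cor 3.7 (v) for the `P`-sub-model modulo Prop 3.2 (iv) surjectivity for `P`** (a
`θ`-free statement with a `θ`-free hypothesis). [cite: MochizukiAbsTopIII2015, Cor 3.7 (v) p.88] -/
theorem model_of_cor_3_7_v_of_full (P : ObjectProperty (TFModel p))
    (hP : ∀ A : TFModel p, P A → IsSlimGroup A.pair.Pi) (hfull : (P.ι ⋙ TFModel.gal p).Full) :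
    ((modelSetting p).restrict P fun _ h => h).Cor_3_7_v :=
  ((modelSetting p).restrict P fun _ h => h).cor_3_7_v_of_lift (biAnabelianLiftOfFull p P hfull)
    (isIdRigid_fullSubcategory_of_slim P hP)

/-- Consistency: Prop 3.2 (iv) surjectivity FAILS for `P =` slim `Π_k` (the swap object of
`BiAnabelianModelLiftVacuity`: slimness alone is not "strictly Belyi type").
[cite: MochizukiAbsTopIII2015, Proposition 3.2 (iv) p.72] -/
theorem not_full_gal_slim :
    ¬ ((ObjectProperty.ι fun A : TFModel p => IsSlimGroup A.pair.Pi) ⋙ TFModel.gal p).Full := fun h =>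
  (isEmpty_biAnabelianLift_modelSettingSlim p).false (biAnabelianLiftOfFull p _ h)

end TFModel

end Literature.AnabelianGeometry.AbsoluteAnabelian.AbsTopIII

end
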